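import Summits.Ventures.LatticeQCDFlow.Scoring.InfiniteVolumeUltralocal2D
import HarnessLib

/-!
# The exact non-abelian area law in two dimensions, V-r: THE JOINT LAW OF FINITELY MANY PLAQUETTES UNDER THE INFINITE-VOLUME STATE IS THE PRODUCT OF TILTED HAAR LAWS

HONEST FRAMING: exact (Metropolis-corrected) sampling algorithms for lattice gauge theory;
figures of merit are autocorrelation/cost numbers at stated couplings and volumes; no
continuum-physics claim.

Venture `LatticeQCDFlow` (cell pub-lqcd), sub-topic `Scoring`; FANOUT row 5 (`s0-sun-a`), GEN-19.
NEW WORK of the cell (placement rule).  V-p (`InfiniteVolumeUltralocal2D`) proved ultralocality for PRODUCTS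
`∏_z f_z(U_z)`; here the joint law itself: for every compact metrisable `G`, continuous `ρ`, real `β`, every
infinite-volume limit point `μ`, every finite set `Z ⊂ ℤ²` and every continuous `Ψ : (Z → G) → ℝ`,
`∫ Ψ((U_z)_{z∈Z}) dμ = ∫ Ψ(u) ∏_{z∈Z} w(u_z) dHaar^{⊗Z}(u) / m^{|Z|}` (`w = e^{−β(N − Re tr ρ)}`, `m = ∫ w dHaar`):
THE PLAQUETTE VARIABLES `(U_z)_{z∈Z}` ARE DISTRIBUTED BY THE PRODUCT MEASURE `⊗_{z∈Z} (w/m) dHaar`.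

* §1 `integral_comp_plaquettes_eq_integral_pi` (torus, general `Ψ`: distinct plaquettes off a puncture have the
  product Haar law — row 30's `map_plaquettes_eq_pi`), `integral_pi_mul_split` (a finite product measure splits
  along a predicate: `∫ f(v|_p) g(v|_{¬p}) = ∫ f · ∫ g`), `integral_pi_comp_equiv` (reindexing);
* §2 **`integral_comp_plaquettes_eq_of_mem_two`** — the joint law, as displayed above.

No `def`, nothing cited as a fact, 0 sorry.
-/

noncomputable section

open MeasureTheory Function Finset Filter Topology
open Literature.MathematicalPhysics.QuantumFieldTheory
open Literature.MathematicalPhysics.QuantumLattice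
open Summit.Ventures.LatticeQCDFlow.Theory2.Lattice
open Summit.Ventures.LatticeQCDFlow.Theory2.Lattice.TwoDim

namespace Summit.Ventures.LatticeQCDFlow.Scoring


/-! ## §1. Product measures: the torus plaquette law, splitting along a predicate, reindexing -/

section Pi

variable {L : ℕ} [NeZero L] {G : Type*} [Group G] [TopologicalSpace G] [IsTopologicalGroup G]
  [CompactSpace G] [SecondCountableTopology G] [MeasurableSpace G] [BorelSpace G]

/-- **Distinct plaquettes off a puncture have the product Haar law** (general observable): for `φ` injective
on `s` with `φ(q) ≠ x₀` and continuous `Ψ`, `∫ Ψ((U_{φ q})_{q∈s}) dHaar^{⊗E} = ∫ Ψ dHaar^{⊗s}` (`L ≥ 2`). -/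
theorem integral_comp_plaquettes_eq_integral_pi (hL : 2 ≤ L) (x₀ : Site 2 L) {ι : Type*} (s : Finset ι)
    (φ : ι → Site 2 L) (hφ : Set.InjOn φ ↑s) (hx₀ : ∀ q ∈ s, φ q ≠ x₀) {Ψ : (↥s → G) → ℝ}
    (hΨ : Continuous Ψ) :
    ∫ U, Ψ (fun q : ↥s => plaquetteHolonomy U (φ q) 0 1) ∂(Measure.pi fun _ : Edge 2 L => haarProbability G) =
      ∫ v, Ψ v ∂(Measure.pi fun _ : ↥s => haarProbability G) := by
  classical
  set π : GaugeConfig 2 L G → ({x : Site 2 L // x ≠ x₀} → G) :=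
    fun U x => plaquetteHolonomy U x.1 0 1 with hπ_def
  have hπ : Measurable π :=
    measurable_pi_lambda _ fun x => (continuous_config_plaquetteHolonomy x.1 0 1).measurable
  set c : ↥s → {x : Site 2 L // x ≠ x₀} := fun q => ⟨φ q, hx₀ q q.2⟩ with hc_def
  have hc : Injective c := fun q q' h => Subtype.ext (hφ q.2 q'.2 (congrArg Subtype.val h))
  have hΨc : Continuous fun u : {x : Site 2 L // x ≠ x₀} → G => Ψ (fun q => u (c q)) :=
    hΨ.comp (continuous_pi fun q => continuous_apply _)
  have h1 : ∀ U : GaugeConfig 2 L G, (fun q : ↥s => plaquetteHolonomy U (φ q) 0 1) =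
      fun q => (π U) (c q) := fun U => rfl
  simp_rw [h1]
  have hmp := measurePreserving_comp_of_injective (haarProbability G) hc
  calc ∫ U, Ψ (fun q => (π U) (c q)) ∂(Measure.pi fun _ : Edge 2 L => haarProbability G)
      = ∫ u, Ψ (fun q => u (c q)) ∂((Measure.pi fun _ : Edge 2 L => haarProbability G).map π) := by
        rw [integral_map hπ.aemeasurable hΨc.aestronglyMeasurable]
    _ = ∫ u, Ψ (fun q => u (c q)) ∂(Measure.pi fun _ : {x : Site 2 L // x ≠ x₀} => haarProbability G) := by
        rw [hπ_def, map_plaquettes_eq_pi hL x₀]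
    _ = ∫ v, Ψ v ∂(Measure.pi fun _ : ↥s => haarProbability G) := by
        rw [← hmp.map_eq, integral_map hmp.measurable.aemeasurable hΨ.aestronglyMeasurable]

omit [NeZero L] [SecondCountableTopology G] in
/-- **A finite product of copies of a probability measure splits along a predicate**:
`∫ f(v|_{p}) g(v|_{¬p}) dμ^{⊗ι}(v) = (∫ f dμ^{⊗{p}}) (∫ g dμ^{⊗{¬p}})`. -/
theorem integral_pi_mul_split {ι : Type*} [Fintype ι] (p : ι → Prop) [DecidablePred p]
    (f : ({i // p i} → G) → ℝ) (g : ({i // ¬p i} → G) → ℝ) :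
    ∫ v, f (fun i => v i.1) * g (fun i => v i.1) ∂(Measure.pi fun _ : ι => haarProbability G) =
      (∫ u, f u ∂(Measure.pi fun _ : {i // p i} => haarProbability G)) *
        ∫ u, g u ∂(Measure.pi fun _ : {i // ¬p i} => haarProbability G) := by
  have hmp := measurePreserving_piEquivPiSubtypeProd (fun _ : ι => haarProbability G) p
  rw [← integral_prod_mul, ← hmp.map_eq, integral_map_equiv]
  rfl

omit [NeZero L] [SecondCountableTopology G] in
/-- **Reindexing a finite product of copies of a probability measure along an equivalence**:
`∫ F(u ∘ e) dμ^{⊗ι}(u) = ∫ F dμ^{⊗κ}` for `e : κ ≃ ι`. -/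
theorem integral_pi_comp_equiv {ι κ : Type*} [Fintype ι] [Fintype κ] (e : κ ≃ ι) (F : (κ → G) → ℝ) :
    ∫ u, F (fun k => u (e k)) ∂(Measure.pi fun _ : ι => haarProbability G) =
      ∫ u', F u' ∂(Measure.pi fun _ : κ => haarProbability G) := by
  have hmp := measurePreserving_piCongrLeft (fun _ : ι => haarProbability G) e
  rw [← hmp.integral_comp']
  refine integral_congr_ae (ae_of_all _ fun u' => ?_)
  show F (fun k => (MeasurableEquiv.piCongrLeft (fun _ : ι => G) e) u' (e k)) = F u'
  congr 1
  funext k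
  rw [MeasurableEquiv.coe_piCongrLeft, Equiv.piCongrLeft_apply_apply]

end Pi

/-! ## §2. The joint law of finitely many plaquettes under the infinite-volume state -/

section InfiniteVolume

variable {G : Type*} [Group G] [TopologicalSpace G] [IsTopologicalGroup G]
  [CompactSpace G] [T2Space G] [SecondCountableTopology G] [MeasurableSpace G] [BorelSpace G] {N : ℕ}
  (ρ : G →* Matrix (Fin N) (Fin N) ℂ)

omit [TopologicalSpace G] [IsTopologicalGroup G] [CompactSpace G] [T2Space G] [SecondCountableTopology G]
  [MeasurableSpace G] [BorelSpace G] in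
/-- An observable of finitely many plaquettes is a cylinder observable supported on their links. -/
theorem isCylinder_comp_plaquettes (Z : Finset (Literature.Probability.LatticeModels.Site 2)) (Ψ : (↥Z → G) → ℝ) :
    IsCylinder (fun V : LGConfig 2 G => Ψ (fun z : ↥Z => plaquetteHolonomyZd V z.1 0 1))
      (Z.biUnion fun z => ({(z, 0), (z + Pi.single 0 1, 1), (z + Pi.single 1 1, 0), (z, 1)} : Finset ((Literature.MathematicalPhysics.QuantumLattice.ZdEdge 2)))) := by
  intro V V' hVV'
  show Ψ _ = Ψ _
  congr 1
  funext z
  have h : ∀ e ∈ ({(z.1, 0), (z.1 + Pi.single 0 1, 1), (z.1 + Pi.single 1 1, 0), (z.1, 1)} : Finset ((Literature.MathematicalPhysics.QuantumLattice.ZdEdge 2))),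
      V e = V' e :=
    fun e he => hVV' e (Finset.mem_coe.2 (Finset.mem_biUnion.2 ⟨z.1, z.2, he⟩))
  simp only [plaquetteHolonomyZd]
  rw [h _ (by simp), h (z.1 + Pi.single 0 1, 1) (by simp), h (z.1 + Pi.single 1 1, 0) (by simp), h (z.1, 1) (by simp)]

/-- **THE JOINT LAW OF FINITELY MANY PLAQUETTES UNDER THE INFINITE-VOLUME STATE IS THE PRODUCT OF TILTED HAAR LAWS.**
For every compact metrisable `G`, continuous `ρ`, real `β`, every infinite-volume limit point `μ`, every finite set `Z`
of sites of `ℤ²` and every continuous `Ψ : (Z → G) → ℝ`: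
`∫ Ψ((U_z)_{z∈Z}) dμ = ∫ Ψ(u) ∏_{z∈Z} w(u_z) dHaar^{⊗Z}(u) / m^{|Z|}` (`w = e^{−β(N − Re tr ρ)}`, `m = ∫ w dHaar`). -/
theorem integral_comp_plaquettes_eq_of_mem_two (hρ : Continuous ρ) {β : ℝ} {μ : Measure (LGConfig 2 G)}
    (hμ : μ ∈ infiniteVolumeLimitPoints ρ β) (Z : Finset (Literature.Probability.LatticeModels.Site 2)) {Ψ : (↥Z → G) → ℝ} (hΨ : Continuous Ψ) :
    ∫ V, Ψ (fun z : ↥Z => plaquetteHolonomyZd V z.1 0 1) ∂μ =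
      (∫ u, Ψ u * ∏ z : ↥Z, Real.exp (-(β * ((N : ℝ) - (ρ (u z)).trace.re)))
          ∂(Measure.pi fun _ : ↥Z => haarProbability G)) /
        (∫ g, Real.exp (-(β * ((N : ℝ) - (ρ g).trace.re))) ∂(haarProbability G)) ^ Z.card := by
  classical
  -- the weight
  have htr : Continuous fun g : G => (ρ g).trace.re := Complex.continuous_re.comp hρ.matrix_trace
  have hw : Continuous fun g : G => Real.exp (-(β * ((N : ℝ) - (ρ g).trace.re))) := by
    have := htr
    fun_prop
  have hm_pos : 0 < ∫ g, Real.exp (-(β * ((N : ℝ) - (ρ g).trace.re))) ∂(haarProbability G) :=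
    integral_exp_pos (integrable_haarProbability_of_continuous hw)
  -- the observable: cylinder, continuous, bounded
  set F : LGConfig 2 G → ℝ := fun V => Ψ (fun z : ↥Z => plaquetteHolonomyZd V z.1 0 1) with hF_def
  set S : Finset ((Literature.MathematicalPhysics.QuantumLattice.ZdEdge 2)) :=
    Z.biUnion fun z => ({(z, 0), (z + Pi.single 0 1, 1), (z + Pi.single 1 1, 0), (z, 1)} : Finset ((Literature.MathematicalPhysics.QuantumLattice.ZdEdge 2))) with hS_def
  have hFS : IsCylinder F S := isCylinder_comp_plaquettes Z Ψ
  have hholc : ∀ z : (Literature.Probability.LatticeModels.Site 2), Continuous fun V : LGConfig 2 G => plaquetteHolonomyZd V z 0 1 := by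
    intro z
    unfold plaquetteHolonomyZd
    fun_prop
  have hFc : Continuous F := hΨ.comp (continuous_pi fun z => hholc z.1)
  obtain ⟨C, hC⟩ : ∃ C, ∀ V, |F V| ≤ C := by
    obtain ⟨C, hC⟩ := isCompact_univ.exists_bound_of_continuousOn hΨ.continuousOn
    exact ⟨C, fun V => by simpa [Real.norm_eq_abs] using hC _ (Set.mem_univ _)⟩
  -- a box containing the plaquettes and their links
  set M : ℕ := (Z.sup fun z => Finset.univ.sup fun i : Fin 2 => (z i).natAbs) + 1 with hM
  have hMle : ∀ z ∈ Z, ∀ i, |z i| + 1 ≤ (M : ℤ) := fun z hz i => by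
    have h1 : (z i).natAbs ≤ Z.sup fun z => Finset.univ.sup fun i : Fin 2 => (z i).natAbs :=
      (Finset.le_sup (f := fun i : Fin 2 => (z i).natAbs) (Finset.mem_univ i)).trans
        (Finset.le_sup (f := fun z : (Literature.Probability.LatticeModels.Site 2) => Finset.univ.sup fun i : Fin 2 => (z i).natAbs) hz)
    have h2 : (z i).natAbs + 1 ≤ M := by rw [hM]; omega
    have h3 : (((z i).natAbs : ℕ) : ℤ) + 1 ≤ (M : ℤ) := by exact_mod_cast h2
    rwa [Int.natCast_natAbs] at h3
  set Box : Finset (Literature.Probability.LatticeModels.Site 2) := (range (2 * M + 1) ×ˢ range (2 * M + 1)).image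
    (fun q : ℕ × ℕ => (![-(M : ℤ) + q.1, -(M : ℤ) + q.2] : (Literature.Probability.LatticeModels.Site 2))) with hBox
  have hmemBox : ∀ y : (Literature.Probability.LatticeModels.Site 2), |y 0| ≤ M → |y 1| ≤ M → y ∈ Box := fun y h0 h1 => by
    have h0' := abs_le.1 h0
    have h1' := abs_le.1 h1
    refine Finset.mem_image.2 ⟨((y 0 + M).toNat, (y 1 + M).toNat),
      Finset.mem_product.2 ⟨Finset.mem_range.2 (by omega), Finset.mem_range.2 (by omega)⟩, ?_⟩
    funext k
    have h01 : ∀ k : Fin 2, k = 0 ∨ k = 1 := by decide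
    rcases h01 k with rfl | rfl
    · simp only [Matrix.cons_val_zero]
      omega
    · simp only [Matrix.cons_val_one, Matrix.cons_val_fin_one]
      omega
  have hZBox : ∀ z ∈ Z, z ∈ Box := fun z hz =>
    hmemBox z (by linarith [hMle z hz 0, abs_nonneg (z 0)]) (by linarith [hMle z hz 1, abs_nonneg (z 1)])
  have hS : ∀ e ∈ S, e.1 ∈ Box := by
    intro e he
    obtain ⟨z, hz, he'⟩ := Finset.mem_biUnion.1 he
    have hz0 := hMle z hz 0
    have hz1 := hMle z hz 1
    have ha0 := abs_le.1 (show |z 0| ≤ (M : ℤ) - 1 by linarith)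
    have ha1 := abs_le.1 (show |z 1| ≤ (M : ℤ) - 1 by linarith)
    simp only [Finset.mem_insert, Finset.mem_singleton] at he'
    rcases he' with rfl | rfl | rfl | rfl
    · exact hZBox z hz
    · refine hmemBox _ ?_ ?_ <;> simp [Pi.add_apply, abs_le] <;> constructor <;> omega
    · refine hmemBox _ ?_ ?_ <;> simp [Pi.add_apply, abs_le] <;> constructor <;> omega
    · exact hZBox z hz
  set E' : Finset ((Literature.MathematicalPhysics.QuantumLattice.ZdEdge 2)) :=
    (Box ∪ Box.image (· + Pi.single 0 1) ∪ Box.image (· + Pi.single 1 1)) ×ˢ Finset.univ with hE'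
  have hSE : S ⊆ E' := fun e he =>
    Finset.mem_product.2 ⟨Finset.mem_union_left _ (Finset.mem_union_left _ (hS e he)), Finset.mem_univ _⟩
  have hE : ∀ z ∈ Box, ((z, 0) : (Literature.MathematicalPhysics.QuantumLattice.ZdEdge 2)) ∈ E' ∧ ((z + Pi.single 0 1, 1) : (Literature.MathematicalPhysics.QuantumLattice.ZdEdge 2)) ∈ E' ∧
      ((z + Pi.single 1 1, 0) : (Literature.MathematicalPhysics.QuantumLattice.ZdEdge 2)) ∈ E' ∧ ((z, 1) : (Literature.MathematicalPhysics.QuantumLattice.ZdEdge 2)) ∈ E' := fun z hz =>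
    ⟨Finset.mem_product.2 ⟨Finset.mem_union_left _ (Finset.mem_union_left _ hz), Finset.mem_univ _⟩,
      Finset.mem_product.2 ⟨Finset.mem_union_left _ (Finset.mem_union_right _
        (Finset.mem_image_of_mem _ hz)), Finset.mem_univ _⟩,
      Finset.mem_product.2 ⟨Finset.mem_union_right _ (Finset.mem_image_of_mem _ hz), Finset.mem_univ _⟩,
      Finset.mem_product.2 ⟨Finset.mem_union_left _ (Finset.mem_union_left _ hz), Finset.mem_univ _⟩⟩
  -- the free-boundary identification (V-k)
  rw [show (∫ V, Ψ (fun z : ↥Z => plaquetteHolonomyZd V z.1 0 1) ∂μ) = ∫ V, F V ∂μ from rfl,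
    integral_eq_freeBoundary_of_mem_two ρ hρ hμ hFS hFc hC hSE hS hE]
  -- continuity of the fixed integrands on `G^{E'}`
  have hpad : Continuous (padConfig (G := G) E') := continuous_padConfig E'
  have hholp : ∀ z : (Literature.Probability.LatticeModels.Site 2), Continuous fun u : ↥E' → G => plaquetteHolonomyZd (padConfig E' u) z 0 1 :=
    fun z => (hholc z).comp hpad
  have hg1 : Continuous fun u : ↥E' → G => ∏ z ∈ Box,
      Real.exp (-(β * ((N : ℝ) - (ρ (plaquetteHolonomyZd (padConfig E' u) z 0 1)).trace.re))) :=
    continuous_finsetProd _ fun z _ => hw.comp (hholp z)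
  have hgF : Continuous fun u : ↥E' → G => F (padConfig E' u) * ∏ z ∈ Box,
      Real.exp (-(β * ((N : ℝ) - (ρ (plaquetteHolonomyZd (padConfig E' u) z 0 1)).trace.re))) :=
    (hFc.comp hpad).mul hg1
  -- a large torus on which `E'` embeds
  obtain ⟨L, hinj, hL⟩ := ((eventually_injOn_torusEdge (d := 2) E').and
    (Filter.eventually_ge_atTop (4 * M + 3))).exists
  have hL2 : 2 ≤ L + 1 := by omega
  have hRn : 2 * M + 1 ≤ L + 1 := by omega
  -- transport both integrals to the torus `(ℤ/(L+1))²`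
  have hnum : ∫ u, F (padConfig E' u) * ∏ z ∈ Box,
        Real.exp (-(β * ((N : ℝ) - (ρ (plaquetteHolonomyZd (padConfig E' u) z 0 1)).trace.re)))
        ∂(Measure.pi fun _ : ↥E' => haarProbability G) =
      ∫ U, toTorusObservable (L + 1) F U * ∏ p ∈ (range (2 * M + 1) ×ˢ range (2 * M + 1)).image
          (fun q : ℕ × ℕ => (![((-(M : ℤ) : ℤ) : ZMod (L + 1)) + q.1, ((-(M : ℤ) : ℤ) : ZMod (L + 1)) + q.2] :
            Site 2 (L + 1))), Real.exp (-(β * ((N : ℝ) - (ρ (plaquetteHolonomy U p 0 1)).trace.re)))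
        ∂(Measure.pi fun _ : Edge 2 (L + 1) => haarProbability G) := by
    rw [← integral_comp_torusEdge_eq hinj hgF]
    refine integral_congr_ae (ae_of_all _ fun U => ?_)
    exact (toTorusObservable_mul_prod_box_eq hFS hSE hE
      (fun g : G => Real.exp (-(β * ((N : ℝ) - (ρ g).trace.re)))) (n := L + 1) hRn hRn U).symm
  have hden : ∫ u, ∏ z ∈ Box,
        Real.exp (-(β * ((N : ℝ) - (ρ (plaquetteHolonomyZd (padConfig E' u) z 0 1)).trace.re)))
        ∂(Measure.pi fun _ : ↥E' => haarProbability G) =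
      ∫ U, ∏ p ∈ (range (2 * M + 1) ×ˢ range (2 * M + 1)).image
          (fun q : ℕ × ℕ => (![((-(M : ℤ) : ℤ) : ZMod (L + 1)) + q.1, ((-(M : ℤ) : ℤ) : ZMod (L + 1)) + q.2] :
            Site 2 (L + 1))), Real.exp (-(β * ((N : ℝ) - (ρ (plaquetteHolonomy U p 0 1)).trace.re)))
        ∂(Measure.pi fun _ : Edge 2 (L + 1) => haarProbability G) := by
    rw [← integral_comp_torusEdge_eq hinj hg1]
    refine integral_congr_ae (ae_of_all _ fun U => ?_)
    have h1 := toTorusObservable_mul_prod_box_eq (F := fun _ : LGConfig 2 G => (1 : ℝ)) (S := S)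
      (fun _ _ _ => rfl) hSE hE (fun g : G => Real.exp (-(β * ((N : ℝ) - (ρ g).trace.re))))
      (n := L + 1) hRn hRn U
    simp only [toTorusObservable_apply, one_mul] at h1
    exact h1.symm
  rw [hnum, hden]
  -- the torus integrands as functions of the box plaquettes
  have hinjBox : ∀ z ∈ Box, ∀ z' ∈ Box, Literature.Probability.LatticeModels.Torus.proj (L + 1) z = Literature.Probability.LatticeModels.Torus.proj (L + 1) z' → z = z' := by
    intro z hz z' hz' h
    have h0 := hinj (Finset.mem_coe.2 (hE z hz).1) (Finset.mem_coe.2 (hE z' hz').1)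
      (show torusEdge (L + 1) ((z, 0) : (Literature.MathematicalPhysics.QuantumLattice.ZdEdge 2)) = torusEdge (L + 1) ((z', 0) : (Literature.MathematicalPhysics.QuantumLattice.ZdEdge 2)) from Prod.ext h rfl)
    exact congrArg Prod.fst h0
  have hReg : (range (2 * M + 1) ×ˢ range (2 * M + 1)).image
      (fun q : ℕ × ℕ => (![((-(M : ℤ) : ℤ) : ZMod (L + 1)) + q.1, ((-(M : ℤ) : ℤ) : ZMod (L + 1)) + q.2] :
        Site 2 (L + 1))) = Box.image (Literature.Probability.LatticeModels.Torus.proj (L + 1)) := (image_proj_box (L + 1) _ _ _ _).symm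
  set x₀ : Site 2 (L + 1) := ![((-(M : ℤ) : ℤ) : ZMod (L + 1)) + ((2 * M + 1 : ℕ) : ZMod (L + 1)),
    ((-(M : ℤ) : ℤ) : ZMod (L + 1))] with hx₀
  have hx₀Box : ∀ z ∈ Box, Literature.Probability.LatticeModels.Torus.proj (L + 1) z ≠ x₀ := by
    intro z hz h
    obtain ⟨q, hq, rfl⟩ := Finset.mem_image.1 hz
    rw [proj_box] at h
    have h0 := congr_fun h 0
    simp only [hx₀, Matrix.cons_val_zero, add_right_inj] at h0
    have hq1 : q.1 < 2 * M + 1 := Finset.mem_range.1 (Finset.mem_product.1 hq).1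
    have h1 := (ZMod.natCast_eq_natCast_iff' q.1 (2 * M + 1) (L + 1)).1 h0
    rw [Nat.mod_eq_of_lt (by omega), Nat.mod_eq_of_lt (by omega)] at h1
    omega
  -- the two observables of the box plaquettes
  set Ψ' : (↥Box → G) → ℝ := fun v =>
    Ψ (fun z : ↥Z => v ⟨z.1, hZBox z.1 z.2⟩) * ∏ x : ↥Box, Real.exp (-(β * ((N : ℝ) - (ρ (v x)).trace.re)))
    with hΨ'
  set Ψ'' : (↥Box → G) → ℝ := fun v => ∏ x : ↥Box, Real.exp (-(β * ((N : ℝ) - (ρ (v x)).trace.re))) with hΨ''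
  have hΨ'c : Continuous Ψ' :=
    (hΨ.comp (continuous_pi fun z => continuous_apply _)).mul
      (continuous_finsetProd _ fun x _ => hw.comp (continuous_apply x))
  have hΨ''c : Continuous Ψ'' := continuous_finsetProd _ fun x _ => hw.comp (continuous_apply x)
  have hF_torus : ∀ U : GaugeConfig 2 (L + 1) G,
      toTorusObservable (L + 1) F U * ∏ p ∈ Box.image (Literature.Probability.LatticeModels.Torus.proj (L + 1)),
          Real.exp (-(β * ((N : ℝ) - (ρ (plaquetteHolonomy U p 0 1)).trace.re))) =
        Ψ' (fun x : ↥Box => plaquetteHolonomy U (Literature.Probability.LatticeModels.Torus.proj (L + 1) x.1) 0 1) := by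
    intro U
    rw [Finset.prod_image hinjBox, toTorusObservable_apply, hF_def, hΨ', ← Finset.prod_coe_sort Box]
    simp only [plaquetteHolonomy_proj]
  have h1_torus : ∀ U : GaugeConfig 2 (L + 1) G,
      ∏ p ∈ Box.image (Literature.Probability.LatticeModels.Torus.proj (L + 1)), Real.exp (-(β * ((N : ℝ) - (ρ (plaquetteHolonomy U p 0 1)).trace.re))) =
        Ψ'' (fun x : ↥Box => plaquetteHolonomy U (Literature.Probability.LatticeModels.Torus.proj (L + 1) x.1) 0 1) := fun U => by
    rw [Finset.prod_image hinjBox, hΨ'', ← Finset.prod_coe_sort Box]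
  simp_rw [hReg, hF_torus, h1_torus]
  rw [integral_comp_plaquettes_eq_integral_pi hL2 x₀ Box (Literature.Probability.LatticeModels.Torus.proj (L + 1))
      (fun z hz z' hz' h => hinjBox z hz z' hz' h) hx₀Box hΨ'c,
    integral_comp_plaquettes_eq_integral_pi hL2 x₀ Box (Literature.Probability.LatticeModels.Torus.proj (L + 1))
      (fun z hz z' hz' h => hinjBox z hz z' hz' h) hx₀Box hΨ''c]
  -- split the box product along `Z`
  set e : ↥Z ≃ {i : ↥Box // i.1 ∈ Z} :=
    { toFun := fun z => ⟨⟨z.1, hZBox z.1 z.2⟩, z.2⟩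
      invFun := fun i => ⟨i.1.1, i.2⟩
      left_inv := fun z => by simp
      right_inv := fun i => by simp } with he
  set f₁ : ({i : ↥Box // i.1 ∈ Z} → G) → ℝ := fun u => Ψ (fun z : ↥Z => u (e z)) *
    ∏ i : {i : ↥Box // i.1 ∈ Z}, Real.exp (-(β * ((N : ℝ) - (ρ (u i)).trace.re))) with hf₁
  set f₂ : ({i : ↥Box // i.1 ∈ Z} → G) → ℝ := fun u =>
    ∏ i : {i : ↥Box // i.1 ∈ Z}, Real.exp (-(β * ((N : ℝ) - (ρ (u i)).trace.re))) with hf₂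
  set g : ({i : ↥Box // ¬ (i.1 ∈ Z)} → G) → ℝ := fun u' =>
    ∏ i : {i : ↥Box // ¬ (i.1 ∈ Z)}, Real.exp (-(β * ((N : ℝ) - (ρ (u' i)).trace.re))) with hg
  have hsplit' : Ψ' = fun v => f₁ (fun i => v i.1) * g (fun i => v i.1) := by
    funext v
    simp only [hΨ', hf₁, hg]
    rw [mul_assoc, Fintype.prod_subtype_mul_prod_subtype (fun i : ↥Box => i.1 ∈ Z)
      (fun x : ↥Box => Real.exp (-(β * ((N : ℝ) - (ρ (v x)).trace.re))))]
    rfl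
  have hsplit'' : Ψ'' = fun v => f₂ (fun i => v i.1) * g (fun i => v i.1) := by
    funext v
    simp only [hΨ'', hf₂, hg]
    rw [Fintype.prod_subtype_mul_prod_subtype (fun i : ↥Box => i.1 ∈ Z)
      (fun x : ↥Box => Real.exp (-(β * ((N : ℝ) - (ρ (v x)).trace.re))))]
  rw [hsplit', hsplit'', integral_pi_mul_split (fun i : ↥Box => i.1 ∈ Z) f₁ g,
    integral_pi_mul_split (fun i : ↥Box => i.1 ∈ Z) f₂ g]
  -- the `Z` factor, reindexed by `e`; the complementary factors are powers of `m`
  have hZfac : ∫ u, f₁ u ∂(Measure.pi fun _ : {i : ↥Box // i.1 ∈ Z} => haarProbability G) =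
      ∫ u', Ψ u' * ∏ z : ↥Z, Real.exp (-(β * ((N : ℝ) - (ρ (u' z)).trace.re)))
        ∂(Measure.pi fun _ : ↥Z => haarProbability G) := by
    rw [← integral_pi_comp_equiv e]
    refine integral_congr_ae (ae_of_all _ fun u => ?_)
    simp only [hf₁]
    rw [← Equiv.prod_comp e (fun i : {i : ↥Box // i.1 ∈ Z} => Real.exp (-(β * ((N : ℝ) - (ρ (u i)).trace.re))))]
  have hp1 : ∫ u, f₂ u ∂(Measure.pi fun _ : {i : ↥Box // i.1 ∈ Z} => haarProbability G) =
      (∫ g, Real.exp (-(β * ((N : ℝ) - (ρ g).trace.re))) ∂(haarProbability G)) ^ Z.card := by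
    have h := integral_fintype_prod_eq_pow (ι := {i : ↥Box // i.1 ∈ Z}) (μ := haarProbability G)
      (fun g : G => Real.exp (-(β * ((N : ℝ) - (ρ g).trace.re))))
    rw [Fintype.card_congr e.symm, Fintype.card_coe] at h
    simpa only [hf₂] using h
  have hp2 : ∫ u, g u ∂(Measure.pi fun _ : {i : ↥Box // ¬ (i.1 ∈ Z)} => haarProbability G) =
      (∫ g, Real.exp (-(β * ((N : ℝ) - (ρ g).trace.re))) ∂(haarProbability G)) ^
        Fintype.card {i : ↥Box // ¬ (i.1 ∈ Z)} := by
    simpa only [hg] using integral_fintype_prod_eq_pow (ι := {i : ↥Box // ¬ (i.1 ∈ Z)})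
      (μ := haarProbability G) (fun g : G => Real.exp (-(β * ((N : ℝ) - (ρ g).trace.re))))
  rw [hZfac, hp1, hp2, mul_div_mul_right _ _ (pow_ne_zero _ hm_pos.ne')]

end InfiniteVolume

end Summit.Ventures.LatticeQCDFlow.Scoring
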